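import Literature.AlgebraicGeometry.HodgeTheory.HardLefschetzNFold
import Literature.AlgebraicGeometry.Motives.BettiRealization
import Literature.AlgebraicTopology.CharacteristicClasses.ProjectiveSpaceLerayHirsch
import Literature.AlgebraicTopology.SingularHomology.CupProductProofs
import HarnessLib

/-!
# COR-CM model layer (M22 input R2): the bridge `Lᵍ_θ 1 = θᵍ` between the two "top power" spellings

Cell `pub-hodgecm2` (COR-CM = stage 2 of the Hodge ladder), seat `b03` (gen 2); row M22 `Fact_algDuality`
of `BINDER-OWNERS.md`, the 10-line bridge asked for by seat model-1 (INBOX 2026-08-20T19:37:54Z).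

Two spellings of "the top power of a degree-`2` class does not vanish" are in use on the M22 path:

* seat b13's `CorCM/Model/RosatiTheta.lean` (`var_exists_rosatiTheta`, `lefschetzPowTo_top_bettiOne_ne_zero`)
  concludes `lefschetzPowTo θ g 0 (2g) _ (bettiOne X) ≠ 0` — the ITERATED LEFT cup product
  `θ ⌣ (θ ⌣ ⋯ ⌣ (θ ⌣ 1))` (`Geometry.Kaehler.lefschetzPow`, `HodgeTheory.lefschetzPowTo`);
* seat b15's `CorCM/Model/PolarizationDatum.lean` (`cupPow_prod4Sum_ne_zero`, `exists_rat_of_polarizationClass`)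
  and seat b16's `CorCM/Model/PolarContraction.lean` (`polarFamily_linearIndependent`) read
  `CharacteristicClasses.cupPow ℚ θ g ≠ 0` — the ITERATED RIGHT cup product `((1 ⌣ θ) ⌣ θ) ⌣ ⋯ ⌣ θ`.

This file proves they are the SAME class, for any commutative coefficient ring and any space
(`lefschetzPowTo_one_eq_cupPow`: induction on `g`, one use of graded commutativity
`cupProduct_gradedComm_holds` in even degree per step; no degree casts are needed because `lefschetzPowTo`
carries its target degree), and records the Betti corollaries model-1's `AlgDualityHolds` consumes
(`lefschetzPowTo_bettiOne_eq_cupPow`, `lefschetzPowTo_bettiOne_ne_zero_iff`,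
`cupPow_ne_zero_of_lefschetzPowTo_bettiOne_ne_zero`).  No definition, no named fact.
-/

noncomputable section

open Literature.AlgebraicTopology.SingularHomology
open Literature.AlgebraicTopology.CharacteristicClasses (cupPow cupPow_zero cupPow_succ)
open Literature.Geometry.Kaehler
open Literature.AlgebraicGeometry.HodgeTheory
open Literature.AlgebraicGeometry.Motives (SchemeOver ComplexPoints bettiCohomology bettiOne)

namespace Summit.HodgeConjecture.CorCM.Model

section General

variable {Y : Type} [TopologicalSpace Y] {R : Type} [CommRing R]

/-- **`Lʲ_κ 1 = κʲ`**: the `j`-fold iterated Lefschetz operator of a class `κ ∈ H²(Y; R)` applied to the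
unit `1 ∈ H⁰(Y; R)`, read in degree `2j` (`HodgeTheory.lefschetzPowTo κ j 0 (2j)`), is the `j`-th cup power
`CharacteristicClasses.cupPow R κ j`.  Induction on `j`: `L⁰ 1 = 1 = κ⁰`, and
`Lʲ⁺¹ 1 = κ ⌣ Lʲ 1 = κ ⌣ κʲ = κʲ ⌣ κ = κʲ⁺¹` by graded commutativity in even degree
(`cupProduct_gradedComm_holds`, sign `(-1)^{2·2j} = 1`). [cite: HatcherAT2002, §3.2 p. 211 and Thm. 3.11] -/
theorem lefschetzPowTo_one_eq_cupPow (κ : singularCohomology R R Y 2) :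
    ∀ (j : ℕ) (h : 0 + 2 * j = 2 * j),
      lefschetzPowTo κ j 0 (2 * j) h (singularCohomology.one R Y) = cupPow R κ j
  | 0, h => by
    rw [cupPow_zero]
    exact lefschetzPowTo_zero_apply κ 0 (singularCohomology.one R Y)
  | j + 1, h => by
    rw [lefschetzPowTo_succ_apply κ j 0 (2 * j) (2 * (j + 1)) (by omega) h (by omega)
        (singularCohomology.one R Y),
      lefschetzPowTo_one_eq_cupPow κ j (by omega), lefschetzOperator_apply, cupPow_succ,
      cupProduct_gradedComm_holds R Y (by omega : 2 + 2 * j = 2 * (j + 1))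
        (by omega : 2 * j + 2 = 2 * (j + 1)) κ (cupPow R κ j)]
    simp

/-- `Lʲ_κ 1 ≠ 0 ↔ κʲ ≠ 0` (the two "top power" spellings agree). [cite: HatcherAT2002, §3.2 p. 211] -/
theorem lefschetzPowTo_one_ne_zero_iff (κ : singularCohomology R R Y 2) (j : ℕ) (h : 0 + 2 * j = 2 * j) :
    lefschetzPowTo κ j 0 (2 * j) h (singularCohomology.one R Y) ≠ 0 ↔ cupPow R κ j ≠ 0 := by
  rw [lefschetzPowTo_one_eq_cupPow κ j h]

end General

section Betti

variable {X : SchemeOver ℂ}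

/-- **Betti form**: for a rational class `θ ∈ H²(X(ℂ); ℚ)` (`Motives.bettiCohomology X 2`),
`lefschetzPowTo θ g 0 (2g) _ (bettiOne X) = cupPow ℚ θ g` in `H²ᵍ(X(ℂ); ℚ)` — seat b13's spelling
(`RosatiTheta.var_exists_rosatiTheta`) equals seat b15/b16's spelling (`PolarizationDatum`,
`PolarContraction.polarFamily_linearIndependent`). [cite: HatcherAT2002, §3.2 p. 211 and Thm. 3.11] -/
theorem lefschetzPowTo_bettiOne_eq_cupPow (θ : bettiCohomology X 2) (g : ℕ) (h : 0 + 2 * g = 2 * g) :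
    lefschetzPowTo θ g 0 (2 * g) h (bettiOne X) = cupPow ℚ θ g :=
  lefschetzPowTo_one_eq_cupPow θ g h

/-- `Lᵍ_θ 1 ≠ 0 ↔ θᵍ ≠ 0` on the rational Betti carriers. [cite: HatcherAT2002, §3.2 p. 211] -/
theorem lefschetzPowTo_bettiOne_ne_zero_iff (θ : bettiCohomology X 2) (g : ℕ) (h : 0 + 2 * g = 2 * g) :
    lefschetzPowTo θ g 0 (2 * g) h (bettiOne X) ≠ 0 ↔ cupPow ℚ θ g ≠ 0 :=
  lefschetzPowTo_one_ne_zero_iff θ g h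

/-- The direction model-1's `AlgDualityHolds` uses: from seat b13's `lefschetzPowTo θ g 0 (2g) _ (bettiOne X) ≠ 0`
to seat b15/b16's `cupPow ℚ θ g ≠ 0`. [cite: HatcherAT2002, §3.2 p. 211] -/
theorem cupPow_ne_zero_of_lefschetzPowTo_bettiOne_ne_zero {θ : bettiCohomology X 2} {g : ℕ}
    {h : 0 + 2 * g = 2 * g} (hθ : lefschetzPowTo θ g 0 (2 * g) h (bettiOne X) ≠ 0) :
    cupPow ℚ θ g ≠ 0 :=
  (lefschetzPowTo_bettiOne_ne_zero_iff θ g h).1 hθ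

/-- The converse direction: `cupPow ℚ θ g ≠ 0` gives b13's `lefschetzPowTo` form (any proof `h` of the
degree identity). [cite: HatcherAT2002, §3.2 p. 211] -/
theorem lefschetzPowTo_bettiOne_ne_zero_of_cupPow_ne_zero {θ : bettiCohomology X 2} {g : ℕ}
    (hθ : cupPow ℚ θ g ≠ 0) (h : 0 + 2 * g = 2 * g) :
    lefschetzPowTo θ g 0 (2 * g) h (bettiOne X) ≠ 0 :=
  (lefschetzPowTo_bettiOne_ne_zero_iff θ g h).2 hθ

end Betti

end Summit.HodgeConjecture.CorCM.Model

end
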